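import Summits.CriticalPhenomena.CardyFormulaZ2.Theorems.CardyIKTransportCornerLineDescentFreezeBlocks
import Literature.Probability.Percolation.SitePercolationMeasure
import Literature.Probability.Percolation.CornerPercolation

/-!
# The frozen end `p = 0` of the corner line: renewal probabilistics of one fair bit sequence, part 1

Support file for the registered stub `stub_FreezeHomogenisation` of the line `symmetric-seed-second-order` of the
crux `CardyIKTransport.CornerLineDescent` (stmt-CriticalPhenomena-10964).  One factor of the frozen gauge is a fair
bit sequence `A : Set ℤ` under `bitLaw = sitePercolation ℤ half` (Mathlib `setBer(univ, ½)`); its FLIPS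
(`Freeze.IsFlip A k`: the bits at `k-1`, `k` differ) are the lines of the renewal grid.  Proved here:
* the flip indicators `flipInd k` are identically distributed (shift invariance of the product measure,
  `setBernoulli_univ_map_preimage`) and independent at distance `≥ 2` (Mathlib `iIndepFun.indepFun_prodMk_prodMk`
  on the independent bits), with mean `½`;
* the STRONG LAW for the flip counts in both directions (anchor `ae_flipDensity_half`): `#flips in (0,n] / n → ½`
  and `#flips in (-n,0] / n → ½` a.s. — Mathlib `ProbabilityTheory.strong_law_ae` applied separately to the odd and
  the even sites (two genuinely i.i.d. sequences), then interleaved; the left side by the reflection `A ↦ -A`;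
Part 2 (`…FreezeRenewal2`) adds a.s. unboundedness of the flips and turns all this into the sup-distortion bound of the
grid and the good-grid event.
References: Grimmett, *Percolation* (1999) §1.3 (product measure); Durrett, *Probability* (2019) Thm. 2.4.1 (SLLN);
route file `Theses/CardyIKTransport.lean` (items 10964, 4967).
-/

noncomputable section

namespace Summit.CriticalPhenomena.CardyFormulaZ2.Theorems.CornerLineDescent.SymmetricSeed

open scoped BigOperators Topology Classical MeasureTheory ProbabilityTheory ENNReal NNReal
open Filter Set Function MeasureTheory ProbabilityTheory
open Literature.Probability.Percolation (sitePercolation half sitePi bernoulliProp)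
open Literature.Probability.LatticeModels

namespace Freeze

/-- The law of one fair bit sequence: Bernoulli site percolation on `ℤ` at density `1/2` (a factor of `fairBits`). [folklore] -/
abbrev bitLaw : Measure (Set ℤ) := sitePercolation ℤ half

/-- The flip indicator at `k`, real-valued. [folklore] -/
def flipInd (k : ℤ) (A : Set ℤ) : ℝ := if IsFlip A k then 1 else 0

/-- Being a flip at `k` is a measurable event (two coordinates). [folklore] -/
theorem measurableSet_isFlip (k : ℤ) : MeasurableSet {A : Set ℤ | IsFlip A k} := by
  have h1 : Measurable fun A : Set ℤ => (k - 1 ∈ A) := measurable_set_mem _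
  have h2 : Measurable fun A : Set ℤ => (k ∈ A) := measurable_set_mem _
  simp only [IsFlip, not_iff]
  exact measurableSet_setOf.2 ((h1.not.iff h2))

/-- The flip indicator is measurable. [folklore] -/
theorem measurable_flipInd (k : ℤ) : Measurable (flipInd k) :=
  Measurable.ite (measurableSet_isFlip k) measurable_const measurable_const

/-- `0 ≤ flipInd`. [folklore] -/
theorem flipInd_nonneg (k : ℤ) (A : Set ℤ) : 0 ≤ flipInd k A := by
  unfold flipInd; split_ifs <;> norm_num

/-- `flipInd ≤ 1`. [folklore] -/
theorem flipInd_le_one (k : ℤ) (A : Set ℤ) : flipInd k A ≤ 1 := by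
  unfold flipInd; split_ifs <;> norm_num

/-- Shift of a bit configuration: `shift t A = {a | a + t ∈ A}`. [folklore] -/
def shift (t : ℤ) (A : Set ℤ) : Set ℤ := (fun a => a + t) ⁻¹' A

/-- Shifts are measurable. [folklore] -/
theorem measurable_shift (t : ℤ) : Measurable (shift t) :=
  measurable_set_iff.2 fun a => measurable_set_mem (a + t)

/-- Shifts preserve the fair bit measure. [folklore] -/
theorem map_shift (t : ℤ) : bitLaw.map (shift t) = bitLaw := by
  unfold bitLaw sitePercolation shift
  exact Literature.Probability.Percolation.setBernoulli_univ_map_preimage (add_left_injective t) half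

/-- Flips of the shifted sequence are shifted flips. [folklore] -/
theorem isFlip_shift (t k : ℤ) (A : Set ℤ) : IsFlip (shift t A) k ↔ IsFlip A (k + t) := by
  simp only [IsFlip, shift, Set.mem_preimage]
  rw [show k - 1 + t = k + t - 1 by ring]

/-- Flip indicators of the shifted sequence. [folklore] -/
theorem flipInd_comp_shift (t k : ℤ) : flipInd k ∘ shift t = flipInd (k + t) := by
  funext A
  simp only [Function.comp_apply, flipInd, isFlip_shift]

/-- All flip indicators have the same law. [folklore] -/
theorem identDistrib_flipInd (k l : ℤ) : IdentDistrib (flipInd k) (flipInd l) bitLaw bitLaw := by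
  refine ⟨(measurable_flipInd k).aemeasurable, (measurable_flipInd l).aemeasurable, ?_⟩
  have hk : flipInd k = flipInd l ∘ shift (k - l) := by rw [flipInd_comp_shift]; ring_nf
  rw [hk, ← Measure.map_map (measurable_flipInd l) (measurable_shift _), map_shift]

/-- The bits are independent. [folklore] -/
theorem iIndepFun_mem : iIndepFun (fun (v : ℤ) (S : Set ℤ) => v ∈ S) bitLaw := by
  rw [iIndepFun_iff_map_fun_eq_infinitePi_map (fun v => measurable_set_mem v)]
  have hS : Measurable fun χ : ℤ → Prop => {v | χ v} := measurable_setOf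
  have h1 : bitLaw.map (fun (S : Set ℤ) (v : ℤ) => v ∈ S) = sitePi ℤ half := by
    rw [show bitLaw = sitePercolation ℤ half from rfl, Literature.Probability.Percolation.sitePercolation_eq_map,
      Measure.map_map (by fun_prop) hS]
    exact Measure.map_id
  rw [h1, sitePi]
  congrm Measure.infinitePi fun v => ?_
  rw [show bitLaw = sitePercolation ℤ half from rfl, Literature.Probability.Percolation.sitePercolation_eq_map,
    Measure.map_map (measurable_set_mem v) hS]
  exact (Measure.infinitePi_map_eval (fun _ : ℤ => bernoulliProp half) v).symm

/-- The flip indicator at `k` as a function of the two bits at `k-1`, `k`. [folklore] -/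
theorem flipInd_eq_comp (k : ℤ) :
    flipInd k = (fun q : Prop × Prop => if ¬ (q.1 ↔ q.2) then (1:ℝ) else 0) ∘
      fun A : Set ℤ => ((k - 1 ∈ A), (k ∈ A)) := by
  funext A
  by_cases h : (k - 1 ∈ A ↔ k ∈ A) <;> simp [flipInd, IsFlip, h]

/-- Flip indicators at sites at distance `≥ 2` are independent. [folklore] -/
theorem indepFun_flipInd {k l : ℤ} (h : k + 1 < l) : IndepFun (flipInd k) (flipInd l) bitLaw := by
  rw [flipInd_eq_comp k, flipInd_eq_comp l]
  refine IndepFun.comp ?_ (measurable_of_countable _) (measurable_of_countable _)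
  exact iIndepFun_mem.indepFun_prodMk_prodMk (fun v => measurable_set_mem v) (k - 1) k (l - 1) l
    (by omega) (by omega) (by omega) (by omega)

/-- The mean of a flip indicator is `1/2`. [folklore] -/
theorem integral_flipInd (k : ℤ) : bitLaw[flipInd k] = 1 / 2 := by
  have hident := identDistrib_flipInd k 1
  rw [hident.integral_eq]
  -- `flipInd 1 = 1` iff exactly one of the bits `0`, `1` is set
  have hind : IndepFun (fun A : Set ℤ => (0:ℤ) ∈ A) (fun A : Set ℤ => (1:ℤ) ∈ A) bitLaw :=
    iIndepFun_mem.indepFun (by norm_num)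
  have hset : ∀ A : Set ℤ, flipInd 1 A = Set.indicator {A | IsFlip A 1} 1 A := by
    intro A; simp [flipInd, Set.indicator]
  simp_rw [hset]
  rw [integral_indicator_one (measurableSet_isFlip 1)]
  have hsplit : {A : Set ℤ | IsFlip A 1} =
      ((fun A : Set ℤ => (0:ℤ) ∈ A) ⁻¹' {True} ∩ (fun A : Set ℤ => (1:ℤ) ∈ A) ⁻¹' {False}) ∪
      ((fun A : Set ℤ => (0:ℤ) ∈ A) ⁻¹' {False} ∩ (fun A : Set ℤ => (1:ℤ) ∈ A) ⁻¹' {True}) := by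
    ext A; simp only [IsFlip, sub_self, mem_setOf_eq, mem_union, mem_inter_iff, mem_preimage,
      mem_singleton_iff, eq_iff_iff, iff_true, iff_false]; tauto
  have hdisj : Disjoint
      ((fun A : Set ℤ => (0:ℤ) ∈ A) ⁻¹' {True} ∩ (fun A : Set ℤ => (1:ℤ) ∈ A) ⁻¹' {False})
      ((fun A : Set ℤ => (0:ℤ) ∈ A) ⁻¹' {False} ∩ (fun A : Set ℤ => (1:ℤ) ∈ A) ⁻¹' {True}) := by
    rw [Set.disjoint_left]; rintro A ⟨h1, -⟩ ⟨h2, -⟩; simp_all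
  have hm0 : ∀ s : Set Prop, MeasurableSet ((fun A : Set ℤ => (0:ℤ) ∈ A) ⁻¹' s) :=
    fun s => measurable_set_mem _ (MeasurableSet.of_discrete)
  have hm1 : ∀ s : Set Prop, MeasurableSet ((fun A : Set ℤ => (1:ℤ) ∈ A) ⁻¹' s) :=
    fun s => measurable_set_mem _ (MeasurableSet.of_discrete)
  rw [hsplit, measureReal_union hdisj ((hm0 _).inter (hm1 _)),
    measureReal_def, measureReal_def,
    hind.measure_inter_preimage_eq_mul _ _ MeasurableSet.of_discrete MeasurableSet.of_discrete,
    hind.measure_inter_preimage_eq_mul _ _ MeasurableSet.of_discrete MeasurableSet.of_discrete]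
  have p0 : bitLaw.real ((fun A : Set ℤ => (0:ℤ) ∈ A) ⁻¹' {True}) = 1 / 2 := by
    have := Literature.Probability.Percolation.sitePercolation_real_mem (V := ℤ) half 0
    simp only [Literature.Probability.Percolation.coe_half] at this
    rw [← this]; congr 1; ext A; simp
  have p1 : bitLaw.real ((fun A : Set ℤ => (1:ℤ) ∈ A) ⁻¹' {True}) = 1 / 2 := by
    have := Literature.Probability.Percolation.sitePercolation_real_mem (V := ℤ) half 1
    simp only [Literature.Probability.Percolation.coe_half] at this
    rw [← this]; congr 1; ext A; simp
  have q0 : bitLaw.real ((fun A : Set ℤ => (0:ℤ) ∈ A) ⁻¹' {False}) = 1 / 2 := by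
    have hc : ((fun A : Set ℤ => (0:ℤ) ∈ A) ⁻¹' {False}) = ((fun A : Set ℤ => (0:ℤ) ∈ A) ⁻¹' {True})ᶜ := by
      ext A; simp
    rw [hc, measureReal_compl (hm0 _), p0]; simp; norm_num
  have q1 : bitLaw.real ((fun A : Set ℤ => (1:ℤ) ∈ A) ⁻¹' {False}) = 1 / 2 := by
    have hc : ((fun A : Set ℤ => (1:ℤ) ∈ A) ⁻¹' {False}) = ((fun A : Set ℤ => (1:ℤ) ∈ A) ⁻¹' {True})ᶜ := by
      ext A; simp
    rw [hc, measureReal_compl (hm1 _), p1]; simp; norm_num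
  rw [ENNReal.toReal_mul, ENNReal.toReal_mul]
  rw [measureReal_def] at p0 p1 q0 q1
  rw [p0, p1, q0, q1]; norm_num

/-- SLLN for the flip indicators along an arithmetic progression of step `2`. [folklore] -/
theorem strong_law_flipInd (r : ℤ) :
    ∀ᵐ A ∂bitLaw, Tendsto (fun n : ℕ => (n : ℝ)⁻¹ • ∑ i ∈ Finset.range n, flipInd (2 * i + r) A)
      atTop (𝓝 (1 / 2)) := by
  have h := strong_law_ae (μ := bitLaw) (fun (i : ℕ) => flipInd (2 * i + r)) ?_ ?_ ?_
  · simp only [Nat.cast_zero, mul_zero, zero_add, integral_flipInd] at h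
    exact h
  · exact (integrable_const (1:ℝ)).mono' (measurable_flipInd _).aestronglyMeasurable
      (Eventually.of_forall fun A => by
        rw [Real.norm_eq_abs, abs_of_nonneg (flipInd_nonneg _ _)]; exact flipInd_le_one _ _)
  · intro i j hij
    simp only [Function.onFun]
    rcases lt_or_gt_of_ne hij with h | h
    · exact indepFun_flipInd (by omega)
    · exact (indepFun_flipInd (by omega)).symm
  · intro i
    exact identDistrib_flipInd _ _

/-! ### Counting flips: the renewal grid in both directions -/

/-- Number of flips of `A` in `(0, n]`. [folklore] -/
def posCount (A : Set ℤ) (n : ℕ) : ℕ := ((Finset.Ioc (0:ℤ) n).filter fun k => IsFlip A k).card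

/-- Number of flips of `A` in `(-n, 0]`. [folklore] -/
def negCount (A : Set ℤ) (n : ℕ) : ℕ := ((Finset.Ioc (-(n:ℤ)) 0).filter fun k => IsFlip A k).card

/-- No flips in the empty interval. [folklore] -/
theorem posCount_zero (A : Set ℤ) : posCount A 0 = 0 := by simp [posCount]

/-- One more cell: `posCount (n+1) = posCount n + flipInd (n+1)`. [folklore] -/
theorem posCount_succ (A : Set ℤ) (n : ℕ) :
    (posCount A (n + 1) : ℝ) = posCount A n + flipInd ((n:ℤ) + 1) A := by
  unfold posCount flipInd
  have h : Finset.Ioc (0:ℤ) ((n + 1 : ℕ) : ℤ) = insert ((n:ℤ) + 1) (Finset.Ioc (0:ℤ) n) := by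
    ext k; simp only [Finset.mem_Ioc, Finset.mem_insert, Nat.cast_add, Nat.cast_one]; omega
  have hn : ((n:ℤ) + 1) ∉ Finset.Ioc (0:ℤ) n := by simp
  rw [h, Finset.filter_insert]
  split_ifs with hf
  · rw [Finset.card_insert_of_notMem (fun h' => hn (Finset.mem_filter.1 h').1)]; push_cast; ring
  · simp

/-- At most one flip per cell. [folklore] -/
theorem posCount_le (A : Set ℤ) (n : ℕ) : posCount A n ≤ n := by
  unfold posCount
  calc _ ≤ (Finset.Ioc (0:ℤ) n).card := Finset.card_filter_le _ _
    _ = n := by simp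

/-- `posCount` is monotone. [folklore] -/
theorem posCount_mono (A : Set ℤ) {m n : ℕ} (h : m ≤ n) : posCount A m ≤ posCount A n := by
  unfold posCount
  exact Finset.card_le_card (Finset.filter_subset_filter _ (Finset.Ioc_subset_Ioc le_rfl (by exact_mod_cast h)))

/-- `posCount (n+1) ≤ posCount n + 1`. [folklore] -/
theorem posCount_succ_le (A : Set ℤ) (n : ℕ) : posCount A (n + 1) ≤ posCount A n + 1 := by
  have h := posCount_succ A n
  have h1 := flipInd_le_one ((n:ℤ) + 1) A
  exact_mod_cast (show (posCount A (n + 1) : ℝ) ≤ posCount A n + 1 by linarith)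

/-- The flips in `(0, 2n]` split into the odd and the even sites. [folklore] -/
theorem posCount_two_mul (A : Set ℤ) (n : ℕ) :
    (posCount A (2 * n) : ℝ) = ∑ i ∈ Finset.range n, flipInd (2 * i + 1) A +
      ∑ i ∈ Finset.range n, flipInd (2 * i + 2) A := by
  induction n with
  | zero => simp [posCount_zero]
  | succ n ih =>
    rw [show 2 * (n + 1) = 2 * n + 1 + 1 by ring, posCount_succ, posCount_succ, ih,
      Finset.sum_range_succ, Finset.sum_range_succ]
    push_cast; ring_nf

/-- `n ↦ n / 2` tends to infinity. [folklore] -/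
theorem tendsto_nat_div_two : Tendsto (fun n : ℕ => n / 2) atTop atTop :=
  tendsto_atTop_atTop.2 fun b => ⟨2 * b, fun n hn => by omega⟩

/-- A.S. DENSITY OF FLIPS TO THE RIGHT: `#{flips in (0,n]} / n → 1/2`. [folklore] -/
theorem ae_tendsto_posCount_div :
    ∀ᵐ A ∂bitLaw, Tendsto (fun n : ℕ => (posCount A n : ℝ) / n) atTop (𝓝 (1 / 2)) := by
  filter_upwards [strong_law_flipInd 1, strong_law_flipInd 2] with A h1 h2
  -- even subsequence
  have he : Tendsto (fun q : ℕ => (posCount A (2 * q) : ℝ) / (2 * q)) atTop (𝓝 (1 / 2)) := by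
    have h12 := (h1.add h2).div_const 2
    rw [show ((1:ℝ) / 2 + 1 / 2) / 2 = 1 / 2 by norm_num] at h12
    refine h12.congr' ?_
    filter_upwards [eventually_gt_atTop 0] with q hq
    rw [posCount_two_mul]
    simp only [smul_eq_mul]
    field_simp
  have hq : Tendsto (fun n : ℕ => (posCount A (2 * (n / 2)) : ℝ) / (2 * (n / 2 : ℕ))) atTop (𝓝 (1 / 2)) :=
    he.comp tendsto_nat_div_two
  -- lower and upper envelopes
  have hlow : Tendsto (fun n : ℕ => (posCount A (2 * (n / 2)) : ℝ) / (2 * (n / 2 : ℕ)) *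
      ((2 * (n / 2 : ℕ) : ℝ) / (2 * (n / 2 : ℕ) + 1))) atTop (𝓝 (1 / 2)) := by
    have hr : Tendsto (fun n : ℕ => ((2 * (n / 2 : ℕ) : ℝ) / (2 * (n / 2 : ℕ) + 1))) atTop (𝓝 1) := by
      have h3 : Tendsto (fun q : ℕ => ((2 * q : ℝ) / (2 * q + 1))) atTop (𝓝 1) := by
        have : Tendsto (fun q : ℕ => 1 - 1 / (2 * (q:ℝ) + 1)) atTop (𝓝 (1 - 0)) := by
          refine tendsto_const_nhds.sub ?_
          refine tendsto_const_nhds.div_atTop ?_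
          exact tendsto_atTop_add_const_right _ _
            ((tendsto_natCast_atTop_atTop (R := ℝ)).const_mul_atTop two_pos)
        rw [sub_zero] at this
        refine this.congr' ?_
        filter_upwards with q
        field_simp; ring
      exact h3.comp tendsto_nat_div_two
    have := hq.mul hr
    rwa [mul_one] at this
  have hup : Tendsto (fun n : ℕ => (posCount A (2 * (n / 2)) : ℝ) / (2 * (n / 2 : ℕ)) +
      1 / (2 * (n / 2 : ℕ))) atTop (𝓝 (1 / 2)) := by
    have hr : Tendsto (fun n : ℕ => (1 : ℝ) / (2 * (n / 2 : ℕ))) atTop (𝓝 0) := by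
      have h3 : Tendsto (fun q : ℕ => (1:ℝ) / (2 * q)) atTop (𝓝 0) :=
        tendsto_const_nhds.div_atTop ((tendsto_natCast_atTop_atTop (R := ℝ)).const_mul_atTop two_pos)
      exact h3.comp tendsto_nat_div_two
    have := hq.add hr
    rwa [add_zero] at this
  refine tendsto_of_tendsto_of_tendsto_of_le_of_le' hlow hup ?_ ?_
  · filter_upwards [eventually_ge_atTop 2] with n hn
    have hq1 : 1 ≤ n / 2 := by omega
    have hnq : 2 * (n / 2) ≤ n := Nat.mul_div_le n 2
    have hnq' : n ≤ 2 * (n / 2) + 1 := by omega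
    have hmono : (posCount A (2 * (n / 2)) : ℝ) ≤ posCount A n := by exact_mod_cast posCount_mono A hnq
    have hpos : (0:ℝ) < 2 * (n / 2 : ℕ) := by positivity
    rw [div_mul_div_comm, mul_comm ((posCount A (2 * (n / 2)) : ℝ)), mul_div_mul_left _ _ hpos.ne']
    calc (posCount A (2 * (n / 2)) : ℝ) / (2 * (n / 2 : ℕ) + 1) ≤ posCount A n / (2 * (n / 2 : ℕ) + 1) :=
          div_le_div_of_nonneg_right hmono (by positivity)
      _ ≤ posCount A n / n := by
          apply div_le_div_of_nonneg_left (by positivity) (by positivity)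
          exact_mod_cast hnq'
  · filter_upwards [eventually_ge_atTop 2] with n hn
    have hq1 : 1 ≤ n / 2 := by omega
    have hnq : 2 * (n / 2) ≤ n := Nat.mul_div_le n 2
    have hnq' : n ≤ 2 * (n / 2) + 1 := by omega
    have hpos : (0:ℝ) < 2 * (n / 2 : ℕ) := by positivity
    -- posCount n ≤ posCount (2q) + 1 (at most one more flip)
    have hstep : posCount A n ≤ posCount A (2 * (n / 2)) + 1 := by
      rcases Nat.lt_or_ge n (2 * (n / 2) + 1) with h | h
      · have : n = 2 * (n / 2) := by omega
        rw [← this]; omega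
      · have : n = 2 * (n / 2) + 1 := by omega
        calc posCount A n = posCount A (2 * (n / 2) + 1) := by rw [← this]
          _ ≤ _ := posCount_succ_le A _
    rw [← add_div]
    calc (posCount A n : ℝ) / n ≤ (posCount A (2 * (n / 2)) + 1 : ℝ) / n := by
          apply div_le_div_of_nonneg_right _ (by positivity); exact_mod_cast hstep
      _ ≤ (posCount A (2 * (n / 2)) + 1 : ℝ) / (2 * (n / 2 : ℕ)) := by
          apply div_le_div_of_nonneg_left (by positivity) hpos; exact_mod_cast hnq

/-- Reflection `A ↦ -A` of a bit configuration. [folklore] -/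
def refl (A : Set ℤ) : Set ℤ := (fun a => -a) ⁻¹' A

/-- Reflection is measurable. [folklore] -/
theorem measurable_refl : Measurable refl := measurable_set_iff.2 fun a => measurable_set_mem (-a)

/-- Reflection preserves the fair bit measure. [folklore] -/
theorem map_refl : bitLaw.map refl = bitLaw := by
  unfold bitLaw sitePercolation refl
  exact Literature.Probability.Percolation.setBernoulli_univ_map_preimage neg_injective half

/-- Flips of the reflected sequence: `k` is a flip of `-A` iff `1 - k` is a flip of `A`. [folklore] -/
theorem isFlip_refl (A : Set ℤ) (k : ℤ) : IsFlip (refl A) k ↔ IsFlip A (1 - k) := by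
  simp only [IsFlip, refl, Set.mem_preimage, neg_sub]
  rw [show (1 : ℤ) - k - 1 = -k by ring]
  tauto

/-- Flips to the left of `0` are flips to the right of `0` of the reflected sequence. [folklore] -/
theorem negCount_eq_posCount_refl (A : Set ℤ) (n : ℕ) : negCount A n = posCount (refl A) n := by
  unfold negCount posCount
  refine Finset.card_bij (fun k _ => 1 - k) ?_ ?_ ?_
  · intro k hk
    simp only [Finset.mem_filter, Finset.mem_Ioc] at hk ⊢
    refine ⟨⟨by omega, by omega⟩, ?_⟩
    rw [isFlip_refl, show 1 - (1 - k) = k by ring]; exact hk.2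
  · intro a _ b _ h; omega
  · intro j hj
    simp only [Finset.mem_filter, Finset.mem_Ioc] at hj
    refine ⟨1 - j, ?_, by ring⟩
    simp only [Finset.mem_filter, Finset.mem_Ioc]
    refine ⟨⟨by omega, by omega⟩, ?_⟩
    have := hj.2; rw [isFlip_refl] at this; exact this

/-- A.S. DENSITY OF FLIPS TO THE LEFT. [folklore] -/
theorem ae_tendsto_negCount_div :
    ∀ᵐ A ∂bitLaw, Tendsto (fun n : ℕ => (negCount A n : ℝ) / n) atTop (𝓝 (1 / 2)) := by
  have h : ∀ᵐ A ∂(bitLaw.map refl), Tendsto (fun n : ℕ => (posCount A n : ℝ) / n) atTop (𝓝 (1 / 2)) := by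
    rw [map_refl]; exact ae_tendsto_posCount_div
  filter_upwards [ae_of_ae_map measurable_refl.aemeasurable h] with A hA
  simp only [negCount_eq_posCount_refl]
  exact hA

end Freeze

/-- ANCHOR (registered sub-goal). THE DENSITY OF FLIPS IS ONE HALF, almost surely, in both directions: under the fair
bit measure, `#{flips in (0, n]} / n → ½` and `#{flips in (-n, 0]} / n → ½` as `n → ∞`. [folklore] -/
theorem ae_flipDensity_half : ∀ᵐ A ∂(sitePercolation ℤ half), Tendsto (fun n : ℕ => (Freeze.posCount A n : ℝ) / n) atTop (𝓝 (1 / 2)) ∧ Tendsto (fun n : ℕ => (Freeze.negCount A n : ℝ) / n) atTop (𝓝 (1 / 2)) := by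
  filter_upwards [Freeze.ae_tendsto_posCount_div, Freeze.ae_tendsto_negCount_div] with A h1 h2
  exact ⟨h1, h2⟩

end Summit.CriticalPhenomena.CardyFormulaZ2.Theorems.CornerLineDescent.SymmetricSeed
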